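import Summits.Ventures.Crystal3D.Theorems.StickyWulffConstantTextureBuildExposedFar
import HarnessLib

/-!
# TB-energy blueprint, CLASS SEMANTICS of the labelled cells: grain and own slab of a piece, the class frame, the four kinds of pieces
# (lane T, crux `TextureLiminfV5`, stmt-Ventures-23912; TB-D-3-g20 §LP2; serves stub_LP2 / stub_LS)

HONEST FRAMING. Venture `Summits/Ventures/Crystal3D` (cell `crystal3d-full`), route `route-Ventures-StickyWulffConstant`, helper `--supports` the
law-v5 crux `TextureLiminfV5` (stmt-Ventures-23912).  Bookkeeping over the labelled cells of a texture input (standard axioms; no mesh constructed; F-C1 not moved).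

WHAT.  The label of a piece `i` is a class `enc (f, s)`; this file decodes it: `grain i`, `slab i` (two small definitions), `grainOf_eq_grain` (the
labelling rule produced them), `subset_laySlab` (a piece lies in its class's own slab, whose constraints are arrangement data), `cls_eq_of`
(grain and slab determine the class), `frameOf_cls` (the class frame IS the canonical frame of bilayer `slab i` of grain `grain i` — by `rfl`), the
grain of territory / prism / gap pieces (`grain_eq_of_piece_subset_D/HD/HP/HQ`: the territory's grain, the cut side's grain, the gap piece's label)
and the four-way classification `piece_cases` (territory polytope / prism / gap piece / riser box).
-/

noncomputable section

open scoped BigOperators InnerProductSpace ENNReal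
open MeasureTheory Set

namespace Summit.Ventures.Crystal3D.Cruxes.TextureLiminf.TexShadow

open Summit.Ventures.Crystal3D Summit.Ventures.Crystal3D.Theorems

namespace TexInput

variable {C R₀ : ℝ} {N : ℕ} {x : Fin N → E3} {rc : RiseredCover C R₀ N x} {δ : ℝ} {μ : Mesh₅ rc δ} (I : TexInput rc μ)

/-! ### Class semantics -/

/-- the GRAIN of piece `i` (first component of its class) -/
def grain (i : Fin I.cells.M) : Fin rc.ng := (I.enc.symm (I.cells.cls i)).1

/-- the OWN-SLAB index of piece `i` (second component of its class) -/
def slab (i : Fin I.cells.M) : ℤ := (I.enc.symm (I.cells.cls i)).2.1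

/-- The own slab is in the grain's window. -/
theorem slab_mem (i : Fin I.cells.M) : I.slab i ∈ I.slabWindow (I.grain i) := (I.enc.symm (I.cells.cls i)).2.2

/-- **The class frame of a piece is the canonical frame of its class's bilayer.** -/
theorem frameOf_cls (i : Fin I.cells.M) : I.frameOf (I.cells.cls i) = (rc.tent (I.grain i)).frame (I.slab i) := rfl

/-- The class is recovered from grain and slab. -/
theorem enc_grain_slab (i : Fin I.cells.M) : I.enc ⟨I.grain i, ⟨I.slab i, I.slab_mem i⟩⟩ = I.cells.cls i := by
  unfold grain slab
  rw [Equiv.apply_eq_iff_eq_symm_apply]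

/-- **Grain and slab determine the class.** -/
theorem cls_eq_of {i i' : Fin I.cells.M} (hg : I.grain i = I.grain i') (hs : I.slab i = I.slab i') : I.cells.cls i = I.cells.cls i' := by
  rw [← I.enc_grain_slab i, ← I.enc_grain_slab i']
  congr 1
  exact Sigma.subtype_ext hg hs

/-- Different classes: different grains or different slabs. -/
theorem grain_ne_or_slab_ne {i i' : Fin I.cells.M} (h : I.cells.cls i' ≠ I.cells.cls i) : I.grain i' ≠ I.grain i ∨ I.slab i' ≠ I.slab i := by
  by_contra h'
  push Not at h'
  exact h (I.cls_eq_of h'.1 h'.2)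

/-- The labelling rule's value on a piece, decoded. -/
theorem grainOf_eq_grain (i : Fin I.cells.M) :
    I.grainOf (I.cells.T (I.cells.idx i)) = some (I.grain i) ∧
      I.slabOf (I.grain i) (I.cells.T (I.cells.idx i)) = some (I.enc.symm (I.cells.cls i)).2 := by
  have hlab : I.lab₀ (I.cells.T (I.cells.idx i)) = some (I.cells.cls i) := I.cells.lab_idx i
  unfold lab₀ at hlab
  cases hg : I.grainOf (I.cells.T (I.cells.idx i)) with
  | none => rw [hg] at hlab; simp at hlab
  | some f =>
    rw [hg] at hlab
    change ((I.slabOf f (I.cells.T (I.cells.idx i))).map fun s => I.enc ⟨f, s⟩) = some (I.cells.cls i) at hlab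
    cases hs : I.slabOf f (I.cells.T (I.cells.idx i)) with
    | none => rw [hs] at hlab; simp at hlab
    | some s =>
      rw [hs] at hlab
      change some (I.enc ⟨f, s⟩) = some (I.cells.cls i) at hlab
      have hsymm : I.enc.symm (I.cells.cls i) = ⟨f, s⟩ := I.enc.symm_apply_eq.2 (Option.some_inj.1 hlab).symm
      unfold grain
      rw [hsymm]
      exact ⟨rfl, hs⟩

/-- The slab branch's value: the own slab's two constraints are in the positive part. -/
theorem laySlabH_subset_of_slabOf {f : Fin rc.ng} {T : Finset (E3 × ℝ)} {s : {s : ℤ // s ∈ I.slabWindow f}} (h : I.slabOf f T = some s) :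
    laySlabH (rc.tent f).L (rc.tent f).s s.1 ⊆ T := by
  classical
  unfold slabOf at h
  split_ifs at h with hex
  · have h' := Option.some_inj.1 h
    rw [← h']
    exact Classical.choose_spec hex

/-- **A piece lies in its class's own slab.** -/
theorem subset_laySlab (i : Fin I.cells.M) :
    polytope (I.cells.Hp i) ⊆ laySlab (rc.tent (I.grain i)).L (rc.tent (I.grain i)).s (I.slab i) := by
  rw [laySlab_eq_polytope]
  exact cell_subset_of_subset_T (I.laySlabH_subset_𝓗 (I.grain i) (I.slab_mem i)) (I.laySlabH_subset_of_slabOf (I.grainOf_eq_grain i).2)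

/-- The own slab's constraints are arrangement data. -/
theorem laySlabH_slab_subset_𝓗 (i : Fin I.cells.M) : laySlabH (rc.tent (I.grain i)).L (rc.tent (I.grain i)).s (I.slab i) ⊆ I.𝓗 :=
  I.laySlabH_subset_𝓗 (I.grain i) (I.slab_mem i)

/-! ### The grain of territory, prism and gap pieces -/

/-- The labelling rule unfolded: which branch produced the grain. -/
theorem grainOf_cases {T : Finset (E3 × ℝ)} {f : Fin rc.ng} (h : I.grainOf T = some f) :
    (∃ j, μ.HC f j ⊆ T) ∨ (∃ j', μ.HD f j' ⊆ T) ∨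
      (∃ k, μ.HP k ⊆ T ∧ f = if I.cutDatum k ∈ T then μ.fk k else μ.gk k) ∨
      (∃ l, μ.HQ l ⊆ T ∧ f = μ.lab l) ∨ (∃ r, μ.HB r ⊆ T ∧ f = I.boxGrain r T) := by
  classical
  unfold grainOf at h
  by_cases h1 : ∃ f : Fin rc.ng, ∃ j, μ.HC f j ⊆ T
  · rw [dif_pos h1] at h
    have hf := Option.some_inj.1 h
    subst hf
    obtain ⟨j, hj⟩ := Classical.choose_spec h1
    exact Or.inl ⟨j, hj⟩
  rw [dif_neg h1] at h
  by_cases h2 : ∃ f : Fin rc.ng, (∃ j, (I.ct f).H j ⊆ T) ∧ ∃ j', μ.HD f j' ⊆ T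
  · rw [dif_pos h2] at h
    have hf := Option.some_inj.1 h
    subst hf
    obtain ⟨-, j', hj'⟩ := Classical.choose_spec h2
    exact Or.inr (Or.inl ⟨j', hj'⟩)
  rw [dif_neg h2] at h
  by_cases h3 : ∃ k : Fin rc.nk, μ.HP k ⊆ T
  · rw [dif_pos h3] at h
    exact Or.inr (Or.inr (Or.inl ⟨Classical.choose h3, Classical.choose_spec h3, (Option.some_inj.1 h).symm⟩))
  rw [dif_neg h3] at h
  by_cases h4 : ∃ l : Fin μ.nQ, μ.HQ l ⊆ T
  · rw [dif_pos h4] at h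
    exact Or.inr (Or.inr (Or.inr (Or.inl ⟨Classical.choose h4, Classical.choose_spec h4, (Option.some_inj.1 h).symm⟩)))
  rw [dif_neg h4] at h
  by_cases h5 : ∃ r : Fin rc.nr, μ.HB r ⊆ T
  · rw [dif_pos h5] at h
    exact Or.inr (Or.inr (Or.inr (Or.inr ⟨Classical.choose h5, Classical.choose_spec h5, (Option.some_inj.1 h).symm⟩)))
  rw [dif_neg h5] at h
  exact absurd h (by simp)

/-- The branches of the labelling rule for piece `i`. -/
theorem grain_cases (i : Fin I.cells.M) :
    (∃ j, polytope (I.cells.Hp i) ⊆ polytope (μ.HC (I.grain i) j)) ∨ (∃ j', polytope (I.cells.Hp i) ⊆ polytope (μ.HD (I.grain i) j')) ∨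
      (∃ k, polytope (I.cells.Hp i) ⊆ polytope (μ.HP k) ∧
        I.grain i = if I.cutDatum k ∈ I.cells.T (I.cells.idx i) then μ.fk k else μ.gk k) ∨
      (∃ l, polytope (I.cells.Hp i) ⊆ polytope (μ.HQ l) ∧ I.grain i = μ.lab l) ∨
      (∃ r, polytope (I.cells.Hp i) ⊆ polytope (μ.HB r) ∧ I.grain i = I.boxGrain r (I.cells.T (I.cells.idx i))) := by
  rcases I.grainOf_cases (I.grainOf_eq_grain i).1 with ⟨j, hj⟩ | ⟨j', hj'⟩ | ⟨k, hk, hf⟩ | ⟨l, hl, hf⟩ | ⟨r, hr, hf⟩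
  · exact Or.inl ⟨j, cell_subset_of_subset_T (I.HC_subset_𝓗 _ j) hj⟩
  · exact Or.inr (Or.inl ⟨j', cell_subset_of_subset_T (I.HD_subset_𝓗 _ j') hj'⟩)
  · exact Or.inr (Or.inr (Or.inl ⟨k, cell_subset_of_subset_T (I.HP_subset_𝓗 k) hk, hf⟩))
  · exact Or.inr (Or.inr (Or.inr (Or.inl ⟨l, cell_subset_of_subset_T (I.HQ_subset_𝓗 l) hl, hf⟩)))
  · exact Or.inr (Or.inr (Or.inr (Or.inr ⟨r, cell_subset_of_subset_T (I.HB_subset_𝓗 r) hr, hf⟩)))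

/-- **A piece inside a territory has that grain.** -/
theorem grain_eq_of_piece_subset_D {i : Fin I.cells.M} {g : Fin rc.ng} (h : polytope (I.cells.Hp i) ⊆ ⋃ j, polytope (μ.HD g j)) :
    I.grain i = g := by
  obtain ⟨z, hz⟩ := I.cells.hne (I.cells.idx i)
  have hzg : z ∈ ⋃ j, polytope (μ.HD g j) := h hz
  rcases I.grain_cases i with ⟨j, hj⟩ | ⟨j', hj'⟩ | ⟨k, hk, -⟩ | ⟨l, hl, -⟩ | ⟨r, hr, -⟩
  · by_contra hne'
    exact Set.disjoint_left.1 (μ.hDD _ g hne') (μ.hCD _ j (hj hz)) hzg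
  · by_contra hne'
    exact Set.disjoint_left.1 (μ.hDD _ g hne') (mem_iUnion.2 ⟨j', hj' hz⟩) hzg
  · exact absurd (hk hz) (Set.disjoint_left.1 (μ.hDP g k) hzg)
  · exact absurd hzg (Set.disjoint_left.1 (μ.hQD l g) (hl hz))
  · exact absurd hzg (Set.disjoint_left.1 (μ.hBD r g) (hr hz))

/-- A piece inside a territory polytope has that grain. -/
theorem grain_eq_of_piece_subset_HD {i : Fin I.cells.M} {g : Fin rc.ng} {jd : Fin (μ.nD g)}
    (h : polytope (I.cells.Hp i) ⊆ polytope (μ.HD g jd)) : I.grain i = g :=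
  I.grain_eq_of_piece_subset_D (h.trans (subset_iUnion (fun j => polytope (μ.HD g j)) jd))

/-- **A piece inside a prism has the grain of its side of the cut.** -/
theorem grain_eq_of_piece_subset_HP {i : Fin I.cells.M} {k : Fin rc.nk} (h : polytope (I.cells.Hp i) ⊆ polytope (μ.HP k)) :
    I.grain i = if I.cutDatum k ∈ I.cells.T (I.cells.idx i) then μ.fk k else μ.gk k := by
  obtain ⟨z, hz⟩ := I.cells.hne (I.cells.idx i)
  have hzk : z ∈ polytope (μ.HP k) := h hz
  rcases I.grain_cases i with ⟨j, hj⟩ | ⟨j', hj'⟩ | ⟨k', hk', hf⟩ | ⟨l, hl, -⟩ | ⟨r, hr, -⟩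
  · exact absurd hzk (Set.disjoint_left.1 (μ.hDP _ k) (μ.hCD _ j (hj hz)))
  · exact absurd hzk (Set.disjoint_left.1 (μ.hDP _ k) (mem_iUnion.2 ⟨j', hj' hz⟩))
  · have hkk : k' = k := by
      by_contra hne'
      exact Set.disjoint_left.1 (μ.hPP k' k hne') (hk' hz) hzk
    subst hkk
    exact hf
  · exact absurd hzk (Set.disjoint_left.1 (μ.hQP l k) (hl hz))
  · exact absurd hzk (Set.disjoint_left.1 (μ.hBP r k) (hr hz))

/-- **A piece inside a gap piece has its label.** -/
theorem grain_eq_of_piece_subset_HQ {i : Fin I.cells.M} {l : Fin μ.nQ} (h : polytope (I.cells.Hp i) ⊆ polytope (μ.HQ l)) :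
    I.grain i = μ.lab l := by
  obtain ⟨z, hz⟩ := I.cells.hne (I.cells.idx i)
  have hzl : z ∈ polytope (μ.HQ l) := h hz
  rcases I.grain_cases i with ⟨j, hj⟩ | ⟨j', hj'⟩ | ⟨k, hk, -⟩ | ⟨l', hl', hf⟩ | ⟨r, hr, -⟩
  · exact absurd (μ.hCD _ j (hj hz)) (Set.disjoint_left.1 (μ.hQD l _) hzl)
  · exact absurd (mem_iUnion.2 ⟨j', hj' hz⟩) (Set.disjoint_left.1 (μ.hQD l _) hzl)
  · exact absurd (hk hz) (Set.disjoint_left.1 (μ.hQP l k) hzl)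
  · have hll : l' = l := by
      by_contra hne'
      exact Set.disjoint_left.1 (μ.hQQ l' l hne') (hl' hz) hzl
    subst hll
    exact hf
  · exact absurd hzl (Set.disjoint_left.1 (μ.hBQ r l) (hr hz))

/-- **The four kinds of pieces**: inside a territory polytope, a prism, a gap piece, or a riser box. -/
theorem piece_cases (i : Fin I.cells.M) :
    (∃ (g : Fin rc.ng) (jd : Fin (μ.nD g)), polytope (I.cells.Hp i) ⊆ polytope (μ.HD g jd)) ∨
      (∃ k, polytope (I.cells.Hp i) ⊆ polytope (μ.HP k)) ∨ (∃ l, polytope (I.cells.Hp i) ⊆ polytope (μ.HQ l)) ∨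
      (∃ r, polytope (I.cells.Hp i) ⊆ polytope (μ.HB r)) := by
  obtain ⟨z, hz⟩ := I.cells.hne (I.cells.idx i)
  rcases I.grain_cases i with ⟨j, hj⟩ | ⟨j', hj'⟩ | ⟨k, hk, -⟩ | ⟨l, hl, -⟩ | ⟨r, hr, -⟩
  · obtain ⟨jd, hjd⟩ := mem_iUnion.1 (μ.hCD _ j (hj hz))
    exact Or.inl ⟨_, jd, I.cell_subset_HD_of_mem hz hjd⟩
  · exact Or.inl ⟨_, j', hj'⟩
  · exact Or.inr (Or.inl ⟨k, hk⟩)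
  · exact Or.inr (Or.inr (Or.inl ⟨l, hl⟩))
  · exact Or.inr (Or.inr (Or.inr ⟨r, hr⟩))

end TexInput

end Summit.Ventures.Crystal3D.Cruxes.TextureLiminf.TexShadow

end
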